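import Summits.QuantumFields.YangMills.Theorems.AlphaInputsT3ACv3LinearLiftTorus1DSeg
import Summits.QuantumFields.YangMills.Theorems.AlphaInputsT3ACv3LinearLiftSegFlat
import Summits.QuantumFields.Balaban3D.Carriers.RadialForest
import HarnessLib

/-!
# `AlphaInputsT3ACv3LinearLiftSpread` — (LL) STEP L2b-ii: THE TENSOR SPREADING OPERATORS `S⁰, S¹, S²` FROM LEVEL `k` TO THE FINEST TORUS AND THEIR CHAIN IDENTITIES
# `d ∘ S⁰ = S¹ ∘ d`, `curl ∘ S¹ = S² ∘ curl`, with the curl-spreading bound — cell `ym3-torus`, width seat `ym-ust-19936-w2` (g0), OWNER re-point 2026-08-27T23:08Z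

WHAT.  With `h = ⌊L^k/2⌋` (`side h = L^k`, `hside`) and the periodised 1-D profiles `Pσ = Psig h`, `Pτ = Ptau h` of `AlphaInputsT3ACv3LinearLiftTorus1D` (fine coordinates
`ZMod (sitesPerDir 0)`, coarse `ZMod (sitesPerDir k)`, `sitesPerDir 0 = L^k · sitesPerDir k`):
* §1 (`hh`, `hside`, `hN`, `shift_bijective`, `sum_shift`) `S0 k λ (x) = Σ_y λ(y) Π_i Pσ(x_i, y_i)`, `S1 k A (x, μ) = Σ_y A(y, μ) Pτ(x_μ, y_μ) Π_{i ≠ μ} Pσ(x_i, y_i)`, `S2 k G (x; μ, ν) = Σ_y G(y; μ, ν) Pτ(x_μ,y_μ) Pτ(x_ν,y_ν) Π_{i ∉ {μ,ν}} Pσ`.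
* §2 ★ `dgrad_S0 : dgrad (S0 k λ) = S1 k (dgrad λ)` and ★ `curlAt_S1 : curlAt (S1 k A) x μ ν = S2 k (curlAt A) x μ ν` (`μ ≠ ν`) — from the chain identity on the circle
  (`Psig_add_one_sub`) and re-indexing the coarse sum by the shift `y ↦ y + e_μ`.
* §3 `abs_S2_le`: if `|G(y; μ, ν)| ≤ ε` for all `y` then `|S2 k G (x; μ, ν)| ≤ 18^d · ε / (L^k)²` (`Σ_c |Pσ(a,c)| ≤ 18`, `Σ_c |Pτ(a,c)| ≤ 18/n`, `Finset.prod_univ_sum`).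
The exactness `segIter k (S1 k A) = A` is the sibling `…LinearLiftBiorth`; the lift is `…LinearLiftTorus` (plan: HOME `ym3-torus/ym-ust-19936-w2/LL-PLAN-w2-g0.md`).
HONEST FRAMING.  Lattice bookkeeping; nothing of [Balaban1987RG1]∕[Balaban1985UV3] asserted; count-neutral helper toward the (FL) row of 2′∕2′χ (`--supports stmt-QuantumFields-19936`);
registry untouched.  YM₃ on the torus is a RUNG of the programme, not the Clay problem; no claim about d = 4, infinite volume or a mass gap.

References: T. Bałaban, Commun. Math. Phys. 109 (1987) 249–301 [Balaban1987RG1] ((0.1) p.251, (0.4) p.253); Commun. Math. Phys. 102 (1985) 255–275 [Balaban1985UV3] ((38) p.266).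
-/

set_option autoImplicit false

noncomputable section

namespace Summit.QuantumFields.YangMills.Theorems.LinearLiftSpread

open Finset
open Literature.MathematicalPhysics.QuantumFieldTheory.Balaban1983to89
open Literature.MathematicalPhysics.QuantumFieldTheory.Balaban1983to89.B5Eq117TorusCarriers (sitesPerDir_zero_eq)
open Summit.QuantumFields.YangMills.Theorems.AbelianEML (curlAt)
open Summit.QuantumFields.YangMills.Theorems.LinearLiftProfile
open Summit.QuantumFields.YangMills.Theorems.LinearLiftGauge (dgrad)
open Summit.QuantumFields.Balaban3D.Carriers (shift_apply_self shift_apply_ne)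

variable {P : Params}

/-! ## §1 The spreading operators -/

/-- The half-width `h = ⌊L^k/2⌋` of a level-`k` cell in fine units (`side h = L^k` since `L` is odd). [cite: Balaban1987RG1, (0.1) p.251] -/
def hh (P : Params) (k : ℕ) : ℕ := P.L ^ k / 2

/-- `side (hh k) = L^k`. [folklore] -/
theorem hside (k : ℕ) : side (hh P k) = P.L ^ k := by
  unfold side hh
  obtain ⟨r, hr⟩ := P.hL.1.pow (n := k)
  omega

/-- `sitesPerDir 0 = side h · sitesPerDir k` (standing range). [cite: Balaban1987RG1, (0.1) p.251] -/
theorem hN (k : ℕ) (hk : k ≤ P.m + P.K) : P.sitesPerDir 0 = side (hh P k) * P.sitesPerDir k := by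
  rw [hside]; exact sitesPerDir_zero_eq hk

/-- **`S⁰`: SPREADING A COARSE 0-FORM** — `S0 k λ (x) = Σ_y λ(y) Π_i Pσ(x_i, y_i)`. [folklore] -/
def S0 (k : ℕ) (lam : Site P k → ℝ) (x : Site P 0) : ℝ :=
  ∑ y : Site P k, lam y * ∏ i, Psig (hh P k) (x i) (y i)

/-- **`S¹`: SPREADING A COARSE 1-FORM** — `S1 k A (x, μ) = Σ_y A(y, μ) · Pτ(x_μ, y_μ) · Π_{i ≠ μ} Pσ(x_i, y_i)`. [folklore] -/
def S1 (k : ℕ) (A : PBond P k → ℝ) (b : PBond P 0) : ℝ :=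
  ∑ y : Site P k, A ⟨y, b.dir⟩ * (Ptau (hh P k) (b.src b.dir) (y b.dir) * ∏ i ∈ univ.erase b.dir, Psig (hh P k) (b.src i) (y i))

/-- **`S²`: SPREADING A COARSE 2-FORM** — `S2 k G (x; μ, ν) = Σ_y G(y; μ, ν) · Pτ(x_μ, y_μ) Pτ(x_ν, y_ν) · Π_{i ∉ {μ, ν}} Pσ(x_i, y_i)`. [folklore] -/
def S2 (k : ℕ) (G : Site P k → Fin P.d → Fin P.d → ℝ) (x : Site P 0) (μ ν : Fin P.d) : ℝ :=
  ∑ y : Site P k, G y μ ν * (Ptau (hh P k) (x μ) (y μ) * Ptau (hh P k) (x ν) (y ν) * ∏ i ∈ (univ.erase μ).erase ν, Psig (hh P k) (x i) (y i))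

/-! ### Site bookkeeping -/

variable {j : ℕ}

/-- The shift `y ↦ y + e_μ` is a bijection of the torus sites. [folklore] -/
theorem shift_bijective (μ : Fin P.d) : Function.Bijective (fun y : Site P j => y.shift μ) :=
  ⟨Function.LeftInverse.injective (g := fun y => y.unshift μ) (fun y => Site.unshift_shift y μ),
    Function.RightInverse.surjective (g := fun y => y.unshift μ) (fun y => Site.shift_unshift y μ)⟩

/-- Re-indexing a sum over the torus sites by the shift `y ↦ y + e_μ`. [folklore] -/
theorem sum_shift (μ : Fin P.d) (f : Site P j → ℝ) : ∑ y : Site P j, f (y.shift μ) = ∑ y : Site P j, f y :=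
  Fintype.sum_bijective _ (shift_bijective μ) (fun y => f (y.shift μ)) f fun _ => rfl

/-! ## §2 The chain identities -/

section Chain

variable (k : ℕ) (hk : k ≤ P.m + P.K)
include hk

/-- **★ `d ∘ S⁰ = S¹ ∘ d`**: the gradient of the spread 0-form is the spread of the coarse gradient. [folklore] -/
theorem dgrad_S0 (lam : Site P k → ℝ) : dgrad (S0 k lam) = S1 k (dgrad lam) := by
  funext b
  obtain ⟨x, μ⟩ := b
  have hN' := hN k hk
  simp only [dgrad, S0, S1, PBond.tgt]
  -- split the product at `μ` on both fine sites
  have eprod : ∀ (z : Site P 0) (y : Site P k), ∏ i, Psig (hh P k) (z i) (y i) = Psig (hh P k) (z μ) (y μ) * ∏ i ∈ univ.erase μ, Psig (hh P k) (z i) (y i) :=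
    fun z y => (mul_prod_erase univ (fun i => Psig (hh P k) (z i) (y i)) (mem_univ μ)).symm
  have eshift : ∀ y : Site P k, ∏ i ∈ univ.erase μ, Psig (hh P k) ((x.shift μ) i) (y i) = ∏ i ∈ univ.erase μ, Psig (hh P k) (x i) (y i) :=
    fun y => prod_congr rfl fun i hi => by rw [shift_apply_ne x (ne_of_mem_erase hi)]
  -- the difference, term by term, through the chain identity on the circle
  have ediff : ∀ y : Site P k, lam y * ∏ i, Psig (hh P k) ((x.shift μ) i) (y i) - lam y * ∏ i, Psig (hh P k) (x i) (y i)
      = lam y * (Ptau (hh P k) (x μ) (y μ - 1) * ∏ i ∈ univ.erase μ, Psig (hh P k) (x i) (y i))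
        - lam y * (Ptau (hh P k) (x μ) (y μ) * ∏ i ∈ univ.erase μ, Psig (hh P k) (x i) (y i)) := by
    intro y
    rw [eprod (x.shift μ) y, eprod x y, eshift y, shift_apply_self, ← mul_sub, ← sub_mul, Psig_add_one_sub (hh P k) hN', sub_mul, mul_sub]
  rw [← sum_sub_distrib, sum_congr rfl fun y _ => ediff y, sum_sub_distrib]
  -- re-index the first sum by `y ↦ y + e_μ`
  have eidx : ∑ y : Site P k, lam y * (Ptau (hh P k) (x μ) (y μ - 1) * ∏ i ∈ univ.erase μ, Psig (hh P k) (x i) (y i))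
      = ∑ y : Site P k, lam (y.shift μ) * (Ptau (hh P k) (x μ) (y μ) * ∏ i ∈ univ.erase μ, Psig (hh P k) (x i) (y i)) := by
    rw [← sum_shift μ (fun y => lam y * (Ptau (hh P k) (x μ) (y μ - 1) * ∏ i ∈ univ.erase μ, Psig (hh P k) (x i) (y i)))]
    refine sum_congr rfl fun y _ => ?_
    rw [shift_apply_self, add_sub_cancel_right]
    congr 2
    exact prod_congr rfl fun i hi => by rw [shift_apply_ne y (ne_of_mem_erase hi)]
  rw [eidx, ← sum_sub_distrib]
  refine sum_congr rfl fun y _ => ?_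
  ring

/-- **★ `curl ∘ S¹ = S² ∘ curl`**: the lattice curl of the spread 1-form is the spread of the coarse curl (`μ ≠ ν`). [folklore] -/
theorem curlAt_S1 (A : PBond P k → ℝ) (x : Site P 0) {μ ν : Fin P.d} (hμν : μ ≠ ν) :
    curlAt (S1 k A) x μ ν = S2 k (fun y μ' ν' => curlAt A y μ' ν') x μ ν := by
  have hN' := hN k hk
  have hνμ : ν ≠ μ := fun h => hμν h.symm
  -- the product over `i ≠ μ` split at `ν`, and vice versa
  have hνmem : ν ∈ univ.erase μ := mem_erase.mpr ⟨hνμ, mem_univ ν⟩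
  have hμmem : μ ∈ univ.erase ν := mem_erase.mpr ⟨hμν, mem_univ μ⟩
  have hsets : (univ.erase ν).erase μ = (univ.erase μ).erase ν := by
    ext i; simp only [mem_erase, mem_univ, and_true]; tauto
  have eμ : ∀ (z : Site P 0) (y : Site P k), ∏ i ∈ univ.erase μ, Psig (hh P k) (z i) (y i)
      = Psig (hh P k) (z ν) (y ν) * ∏ i ∈ (univ.erase μ).erase ν, Psig (hh P k) (z i) (y i) :=
    fun z y => (mul_prod_erase (univ.erase μ) (fun i => Psig (hh P k) (z i) (y i)) hνmem).symm
  have eν : ∀ (z : Site P 0) (y : Site P k), ∏ i ∈ univ.erase ν, Psig (hh P k) (z i) (y i)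
      = Psig (hh P k) (z μ) (y μ) * ∏ i ∈ (univ.erase μ).erase ν, Psig (hh P k) (z i) (y i) := by
    intro z y; rw [← hsets]; exact (mul_prod_erase (univ.erase ν) (fun i => Psig (hh P k) (z i) (y i)) hμmem).symm
  -- the inner products do not see the shifts in `μ` or `ν`
  have erest : ∀ (ρ : Fin P.d) (y : Site P k), ∏ i ∈ (univ.erase μ).erase ν, Psig (hh P k) ((x.shift ρ) i) (y i)
      = ∏ i ∈ (univ.erase μ).erase ν, Psig (hh P k) (x i) (y i) ∨ (ρ ≠ μ ∧ ρ ≠ ν) := by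
    intro ρ y
    by_cases h1 : ρ = μ
    · left; exact prod_congr rfl fun i hi => by
        rw [shift_apply_ne x (show i ≠ ρ from h1 ▸ ne_of_mem_erase (mem_of_mem_erase hi))]
    · by_cases h2 : ρ = ν
      · left; exact prod_congr rfl fun i hi => by rw [shift_apply_ne x (show i ≠ ρ from h2 ▸ ne_of_mem_erase hi)]
      · right; exact ⟨h1, h2⟩
  have erestμ : ∀ y : Site P k, ∏ i ∈ (univ.erase μ).erase ν, Psig (hh P k) ((x.shift μ) i) (y i) = ∏ i ∈ (univ.erase μ).erase ν, Psig (hh P k) (x i) (y i) :=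
    fun y => (erest μ y).resolve_right fun h => h.1 rfl
  have erestν : ∀ y : Site P k, ∏ i ∈ (univ.erase μ).erase ν, Psig (hh P k) ((x.shift ν) i) (y i) = ∏ i ∈ (univ.erase μ).erase ν, Psig (hh P k) (x i) (y i) :=
    fun y => (erest ν y).resolve_right fun h => h.2 rfl
  -- abbreviations
  set R : Site P k → ℝ := fun y => ∏ i ∈ (univ.erase μ).erase ν, Psig (hh P k) (x i) (y i) with hR
  set Tμ : Site P k → ℝ := fun y => Ptau (hh P k) (x μ) (y μ) with hTμ
  set Tν : Site P k → ℝ := fun y => Ptau (hh P k) (x ν) (y ν) with hTν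
  -- the four terms of the curl
  have t1 : S1 k A ⟨x, μ⟩ = ∑ y, A ⟨y, μ⟩ * (Tμ y * (Psig (hh P k) (x ν) (y ν) * R y)) := by
    simp only [S1, hTμ, hR]; exact sum_congr rfl fun y _ => by rw [eμ]
  have t2 : S1 k A ⟨x.shift μ, ν⟩ = ∑ y, A ⟨y, ν⟩ * (Tν y * (Psig (hh P k) (x μ + 1) (y μ) * R y)) := by
    simp only [S1, hTν, hR]
    exact sum_congr rfl fun y _ => by rw [eν, shift_apply_ne x hνμ, shift_apply_self, erestμ]
  have t3 : S1 k A ⟨x.shift ν, μ⟩ = ∑ y, A ⟨y, μ⟩ * (Tμ y * (Psig (hh P k) (x ν + 1) (y ν) * R y)) := by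
    simp only [S1, hTμ, hR]
    exact sum_congr rfl fun y _ => by rw [eμ, shift_apply_ne x hμν, shift_apply_self, erestν]
  have t4 : S1 k A ⟨x, ν⟩ = ∑ y, A ⟨y, ν⟩ * (Tν y * (Psig (hh P k) (x μ) (y μ) * R y)) := by
    simp only [S1, hTν, hR]; exact sum_congr rfl fun y _ => by rw [eν]
  unfold curlAt
  rw [t1, t2, t3, t4]
  -- combine: the `ν`-terms give `A(y,ν)·Tν·(ΔPsig_μ)·R`, the `μ`-terms give `−A(y,μ)·Tμ·(ΔPsig_ν)·R`
  have eA : ∑ y, A ⟨y, ν⟩ * (Tν y * (Psig (hh P k) (x μ + 1) (y μ) * R y)) - ∑ y, A ⟨y, ν⟩ * (Tν y * (Psig (hh P k) (x μ) (y μ) * R y))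
      = ∑ y, A ⟨y.shift μ, ν⟩ * (Tμ y * Tν y * R y) - ∑ y, A ⟨y, ν⟩ * (Tμ y * Tν y * R y) := by
    rw [← sum_sub_distrib, ← sum_sub_distrib]
    have e1 : ∀ y, A ⟨y, ν⟩ * (Tν y * (Psig (hh P k) (x μ + 1) (y μ) * R y)) - A ⟨y, ν⟩ * (Tν y * (Psig (hh P k) (x μ) (y μ) * R y))
        = A ⟨y, ν⟩ * (Tν y * (Ptau (hh P k) (x μ) (y μ - 1) * R y)) - A ⟨y, ν⟩ * (Tμ y * Tν y * R y) := by
      intro y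
      have hc := Psig_add_one_sub (hh P k) hN' (x μ) (y μ)
      simp only [hTμ]
      linear_combination (A ⟨y, ν⟩ * Tν y * R y) * hc
    rw [sum_congr rfl fun y _ => e1 y, sum_sub_distrib, sum_sub_distrib]
    congr 1
    rw [← sum_shift μ (fun y => A ⟨y, ν⟩ * (Tν y * (Ptau (hh P k) (x μ) (y μ - 1) * R y)))]
    refine sum_congr rfl fun y _ => ?_
    simp only [hTμ, hTν, hR, shift_apply_self, add_sub_cancel_right, shift_apply_ne y hνμ]
    have : ∏ i ∈ (univ.erase μ).erase ν, Psig (hh P k) (x i) ((y.shift μ) i) = ∏ i ∈ (univ.erase μ).erase ν, Psig (hh P k) (x i) (y i) :=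
      prod_congr rfl fun i hi => by rw [shift_apply_ne y (ne_of_mem_erase (mem_of_mem_erase hi))]
    rw [this]; ring
  have eB : ∑ y, A ⟨y, μ⟩ * (Tμ y * (Psig (hh P k) (x ν + 1) (y ν) * R y)) - ∑ y, A ⟨y, μ⟩ * (Tμ y * (Psig (hh P k) (x ν) (y ν) * R y))
      = ∑ y, A ⟨y.shift ν, μ⟩ * (Tμ y * Tν y * R y) - ∑ y, A ⟨y, μ⟩ * (Tμ y * Tν y * R y) := by
    rw [← sum_sub_distrib, ← sum_sub_distrib]
    have e1 : ∀ y, A ⟨y, μ⟩ * (Tμ y * (Psig (hh P k) (x ν + 1) (y ν) * R y)) - A ⟨y, μ⟩ * (Tμ y * (Psig (hh P k) (x ν) (y ν) * R y))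
        = A ⟨y, μ⟩ * (Tμ y * (Ptau (hh P k) (x ν) (y ν - 1) * R y)) - A ⟨y, μ⟩ * (Tμ y * Tν y * R y) := by
      intro y
      have hc := Psig_add_one_sub (hh P k) hN' (x ν) (y ν)
      simp only [hTν]
      linear_combination (A ⟨y, μ⟩ * Tμ y * R y) * hc
    rw [sum_congr rfl fun y _ => e1 y, sum_sub_distrib, sum_sub_distrib]
    congr 1
    rw [← sum_shift ν (fun y => A ⟨y, μ⟩ * (Tμ y * (Ptau (hh P k) (x ν) (y ν - 1) * R y)))]
    refine sum_congr rfl fun y _ => ?_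
    simp only [hTμ, hTν, hR, shift_apply_self, add_sub_cancel_right, shift_apply_ne y hμν]
    have : ∏ i ∈ (univ.erase μ).erase ν, Psig (hh P k) (x i) ((y.shift ν) i) = ∏ i ∈ (univ.erase μ).erase ν, Psig (hh P k) (x i) (y i) :=
      prod_congr rfl fun i hi => by rw [shift_apply_ne y (ne_of_mem_erase hi)]
    rw [this]; ring
  have key : (∑ y, A ⟨y, μ⟩ * (Tμ y * (Psig (hh P k) (x ν) (y ν) * R y))) + (∑ y, A ⟨y, ν⟩ * (Tν y * (Psig (hh P k) (x μ + 1) (y μ) * R y)))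
      - (∑ y, A ⟨y, μ⟩ * (Tμ y * (Psig (hh P k) (x ν + 1) (y ν) * R y))) - (∑ y, A ⟨y, ν⟩ * (Tν y * (Psig (hh P k) (x μ) (y μ) * R y)))
      = (∑ y, A ⟨y.shift μ, ν⟩ * (Tμ y * Tν y * R y) - ∑ y, A ⟨y, ν⟩ * (Tμ y * Tν y * R y))
        - (∑ y, A ⟨y.shift ν, μ⟩ * (Tμ y * Tν y * R y) - ∑ y, A ⟨y, μ⟩ * (Tμ y * Tν y * R y)) := by
    rw [← eA, ← eB]; ring
  rw [key]
  simp only [S2, hTμ, hTν, hR, ← sum_sub_distrib]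
  refine sum_congr rfl fun y _ => ?_
  ring

end Chain

/-! ## §3 The curl-spreading bound -/

/-- `Σ_c |PS f q t c| ≤ 3·C` when `|f| ≤ C` (only the three relative positions contribute). [folklore] -/
theorem sum_abs_PS_le {Nk : ℕ} [NeZero Nk] (h : ℕ) (f : ℤ → ℝ) {C : ℝ} (hC : ∀ s, |f s| ≤ C) (q t : ℤ) :
    ∑ c : ZMod Nk, |PS h f q t c| ≤ 3 * C := by
  have hC0 : 0 ≤ C := (abs_nonneg _).trans (hC 0)
  unfold PS
  calc ∑ c : ZMod Nk, |∑ r ∈ trip, (if c = ((q - r : ℤ) : ZMod Nk) then f (t + r * side h) else 0)|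
      ≤ ∑ c : ZMod Nk, ∑ r ∈ trip, |(if c = ((q - r : ℤ) : ZMod Nk) then f (t + r * side h) else 0)| :=
        sum_le_sum fun c _ => abs_sum_le_sum_abs _ _
    _ = ∑ r ∈ trip, ∑ c : ZMod Nk, |(if c = ((q - r : ℤ) : ZMod Nk) then f (t + r * side h) else 0)| := sum_comm
    _ = ∑ r ∈ trip, |f (t + r * side h)| := by
        refine sum_congr rfl fun r _ => ?_
        have : ∀ c : ZMod Nk, |(if c = ((q - r : ℤ) : ZMod Nk) then f (t + r * side h) else 0)| =
            (if c = ((q - r : ℤ) : ZMod Nk) then |f (t + r * side h)| else 0) := fun c => by split_ifs <;> simp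
        simp_rw [this]
        rw [sum_ite_eq']; simp
    _ ≤ ∑ _r ∈ trip, C := sum_le_sum fun r _ => hC _
    _ = 3 * C := by
        have hcard : (trip).card = 3 := by simp [trip]
        rw [sum_const, hcard, nsmul_eq_mul]; norm_num

/-- **THE CURL-SPREADING BOUND**: if `|G(y; μ, ν)| ≤ ε` for every coarse site then `|S2 k G (x; μ, ν)| ≤ 18^d · ε / (L^k)²` (`μ ≠ ν`). [folklore] -/
theorem abs_S2_le (k : ℕ) (G : Site P k → Fin P.d → Fin P.d → ℝ) (x : Site P 0) {μ ν : Fin P.d} (hμν : μ ≠ ν) {ε : ℝ}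
    (hG : ∀ y, |G y μ ν| ≤ ε) :
    |S2 k G x μ ν| ≤ (18 : ℝ) ^ P.d * ε / ((P.L : ℝ) ^ k) ^ 2 := by
  have hε : 0 ≤ ε := (abs_nonneg _).trans (hG (fun _ => 0))
  have hn : (0 : ℝ) < side (hh P k) := side_real_pos _
  have hνμ : ν ≠ μ := fun h => hμν h.symm
  -- the weight of `y` as a product over ALL coordinates of per-coordinate factors
  let w : Fin P.d → ZMod (P.sitesPerDir 0) → ZMod (P.sitesPerDir k) → ℝ := fun i a c =>
    if i = μ ∨ i = ν then Ptau (hh P k) a c else Psig (hh P k) a c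
  have hw : ∀ y : Site P k, Ptau (hh P k) (x μ) (y μ) * Ptau (hh P k) (x ν) (y ν) * ∏ i ∈ (univ.erase μ).erase ν, Psig (hh P k) (x i) (y i)
      = ∏ i, w i (x i) (y i) := by
    intro y
    rw [← mul_prod_erase univ (fun i => w i (x i) (y i)) (mem_univ μ),
      ← mul_prod_erase (univ.erase μ) (fun i => w i (x i) (y i)) (mem_erase.mpr ⟨hνμ, mem_univ ν⟩)]
    simp only [w, if_pos (Or.inl rfl), if_pos (Or.inr rfl), mul_assoc]
    congr 2
    exact prod_congr rfl fun i hi => by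
      rw [if_neg (not_or.mpr ⟨ne_of_mem_erase (mem_of_mem_erase hi), ne_of_mem_erase hi⟩)]
  -- per-coordinate sums of absolute values
  have hsum : ∀ i, ∑ c : ZMod (P.sitesPerDir k), |w i (x i) c| ≤ if i = μ ∨ i = ν then (18 : ℝ) / (side (hh P k) : ℝ) else (18 : ℝ) := by
    intro i
    by_cases h : i = μ ∨ i = ν
    · simp only [w, if_pos h]
      have := sum_abs_PS_le (Nk := P.sitesPerDir k) (hh P k) (tau (hh P k)) (abs_tau_le (hh P k)) (qIdx (hh P k) (x i) : ℤ) (tOff (hh P k) (x i))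
      unfold Ptau
      calc _ ≤ 3 * (6 / (side (hh P k) : ℝ)) := this
        _ = 18 / side (hh P k) := by ring
    · simp only [w, if_neg h]
      have := sum_abs_PS_le (Nk := P.sitesPerDir k) (hh P k) (sigma (hh P k)) (abs_sigma_le (hh P k)) (qIdx (hh P k) (x i) : ℤ) (tOff (hh P k) (x i))
      unfold Psig
      linarith
  calc |S2 k G x μ ν| = |∑ y : Site P k, G y μ ν * ∏ i, w i (x i) (y i)| := by
        unfold S2; exact congrArg _ (sum_congr rfl fun y _ => by rw [hw])
    _ ≤ ∑ y : Site P k, |G y μ ν * ∏ i, w i (x i) (y i)| := abs_sum_le_sum_abs _ _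
    _ ≤ ∑ y : Site P k, ε * ∏ i, |w i (x i) (y i)| := by
        refine sum_le_sum fun y _ => ?_
        rw [abs_mul, abs_prod]
        exact mul_le_mul_of_nonneg_right (hG y) (prod_nonneg fun i _ => abs_nonneg _)
    _ = ε * ∏ i, ∑ c : ZMod (P.sitesPerDir k), |w i (x i) c| := by
        rw [← mul_sum, Finset.prod_univ_sum]
        rfl
    _ ≤ ε * ∏ i, (if i = μ ∨ i = ν then (18 : ℝ) / (side (hh P k) : ℝ) else (18 : ℝ)) := by
        refine mul_le_mul_of_nonneg_left ?_ hε
        exact prod_le_prod (fun i _ => sum_nonneg fun c _ => abs_nonneg _) fun i _ => hsum i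
    _ = ε * ((18 : ℝ) ^ P.d / (side (hh P k) : ℝ) ^ 2) := by
        congr 1
        rw [← mul_prod_erase univ _ (mem_univ μ), ← mul_prod_erase (univ.erase μ) _ (mem_erase.mpr ⟨hνμ, mem_univ ν⟩)]
        rw [if_pos (Or.inl rfl), if_pos (Or.inr rfl)]
        have hrest : ∏ i ∈ (univ.erase μ).erase ν, (if i = μ ∨ i = ν then (18 : ℝ) / (side (hh P k) : ℝ) else (18 : ℝ)) = (18 : ℝ) ^ ((univ.erase μ).erase ν).card := by
          rw [← prod_const]
          exact prod_congr rfl fun i hi => by rw [if_neg (not_or.mpr ⟨ne_of_mem_erase (mem_of_mem_erase hi), ne_of_mem_erase hi⟩)]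
        rw [hrest, card_erase_of_mem (mem_erase.mpr ⟨hνμ, mem_univ ν⟩), card_erase_of_mem (mem_univ μ), card_univ, Fintype.card_fin]
        have hd : 2 ≤ P.d := by
          have : ({μ, ν} : Finset (Fin P.d)).card ≤ Fintype.card (Fin P.d) := Finset.card_le_univ _
          rw [card_pair hμν, Fintype.card_fin] at this
          exact this
        have e : (18 : ℝ) ^ P.d = 18 * 18 * (18 : ℝ) ^ (P.d - 1 - 1) := by
          rw [← pow_two, ← pow_add]; congr 1; omega
        rw [e]; field_simp
    _ = (18 : ℝ) ^ P.d * ε / ((P.L : ℝ) ^ k) ^ 2 := by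
        rw [show (side (hh P k) : ℝ) = (P.L : ℝ) ^ k by rw [hside]; push_cast; ring]; ring

end Summit.QuantumFields.YangMills.Theorems.LinearLiftSpread

end
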